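import Summits.BirchSwinnertonDyer.BirchSwinnertonDyer.Theorems.SignedLowerHalvesKobayashiLowerHalfLargeImageCongruencePlacesGood
import Literature.NumberTheory.EllipticCurves.ComplexMultiplicationLocalFactorsAux
import HarnessLib

/-!
# Route `SignedLowerHalves`, crux `KobayashiLowerHalfLargeImage` (item stmt-BirchSwinnertonDyer-19001):
# the congruence road's PLACE TOOLKIT at a GOOD prime from a POINT-COUNT HYPOTHESIS (any `ℓ`, in
# particular `ℓ = 2`) (cell `bsd-ssimc`, seat `bsd-ssimc-k3-c3` gen 9, object «X7-RESIDUE-ROADS»; a `--supports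
# stmt-BirchSwinnertonDyer-19001 --as helper` file; closes nothing)

PARTITION (cell bsd-ssimc): X7 (A7) × item 3's rank-one window on the RANK-DONOR congruence road — the kernel
bookkeeping case `2 ∈ Σ₀` with one of `E`, `E′` GOOD at `2` (the donor records at `p = 3, 5` need it: 21 desk-residue
cells): Greenberg–Vatsal's `δ^{(ℓ)} = s_ℓ · d_ℓ` at a good place from the point count `#Ẽ₀(𝔽_ℓ) = n` supplied as a
HYPOTHESIS on the integer model (`…CongruencePlaces.lean` p467415 / `…PlacesGood.lean` p495616 take the count from the
odd-`ℓ` schema `countPoints`; at `ℓ = 2` the count is decided on the explicit curve over `𝔽₂` by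
`natCard_point_eq_one_add_card`). THEOREMS ONLY: no definition, no named fact, nothing about any curve asserted; BSD
is not proved by any of this.

References: [GreenbergVatsal2000] §2 Prop. (2.4) (p. 22), p. 27; [SilvermanAEC2009] VII.5 Prop. 5.1, V.2.
-/

set_option autoImplicit false
set_option linter.dupNamespace false
noncomputable section

open scoped Classical

open WeierstrassCurve NumberField IsDedekindDomain Rat.HeightOneSpectrum
  Literature.NumberTheory.EllipticCurves
  Literature.NumberTheory.EllipticCurves.Rank1Residual
  Literature.NumberTheory.EllipticCurves.GreenbergVatsal2000
  Literature.NumberTheory.EllipticCurves.Rank1Residual.X11RankOneCertificates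
  Summit.BirchSwinnertonDyer.Rank1Residual.Supersingular
  Summit.BirchSwinnertonDyer.Rank1Residual.X2.LocalDeltaCalculus
  Summit.BirchSwinnertonDyer.BirchSwinnertonDyer.Rank1Residual.IntModel
  Summit.BirchSwinnertonDyer.BirchSwinnertonDyer.Rank1Residual.X11RankOne

namespace Summit.BirchSwinnertonDyer.BirchSwinnertonDyer.Theorems.CongruenceRoad

variable {W : WeierstrassCurve ℚ} [W.IsElliptic] [W.IsGloballyMinimal] {E₀ : WeierstrassCurve ℤ}
  (hI : integralModelInt W = E₀)

include hI in
/-- **Good at the place over `ℓ ∤ pΔ` with `p ∣ #Ẽ₀(𝔽_ℓ)`** (count given as a hypothesis on the integer model; any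
`ℓ ≠ p` with `natGenerator v = ℓ`, e.g. `ℓ = 2`) ⇒ `δ = s_ℓ · (1 + [ℓ ≡ 1 (mod p)])`. [cite: GreenbergVatsal2000, §2 Prop. (2.4) and p. 27] -/
theorem delta_eq_of_good_of_card (p : ℕ) [hp : Fact p.Prime] (v : HeightOneSpectrum (𝓞 ℚ)) (ℓ : ℕ)
    (hvℓ : natGenerator v = ℓ) (hℓp : ℓ ≠ p) (hΔ : ¬ (ℓ : ℤ) ∣ E₀.Δ) {n : ℕ}
    (hcard : Nat.card ((E₀.map (Int.castRingHom (ZMod ℓ))).toAffine.Point) = n) (hpn : (p : ℤ) ∣ (n : ℤ)) :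
    delta W p v = sFactor p ℓ * (if (ℓ : ZMod p) = 1 then 2 else 1) := by
  subst hvℓ
  haveI := Fact.mk (primesEquiv v).2
  have hgood : W.HasGoodReductionAt v := hasGoodReductionAt_of_not_dvd hI v (by exact_mod_cast hΔ)
  have htr : W.frobeniusTraceAt v = ((natGenerator v : ℕ) : ℤ) + 1 - n := by
    rw [frobeniusTraceAt_eq_frobeniusTrace]
    change W.frobeniusTrace (natGenerator v) = _
    rw [frobeniusTrace_eq hI hcard]
  have hdvd : (p : ℤ) ∣ ((natGenerator v : ℕ) + 1 - W.frobeniusTraceAt v : ℤ) := by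
    rw [htr]; ring_nf; exact hpn
  rw [delta_eq, dMultiplicity_of_hasGoodReductionAt_of_dvd hgood hℓp hdvd]

include hI in
/-- **Good at the place over `ℓ ∤ pΔ` with `p ∤ #Ẽ₀(𝔽_ℓ)`** (count given as a hypothesis on the integer model; any
`ℓ ≠ p`) ⇒ `δ = 0`. [cite: GreenbergVatsal2000, §2 Prop. (2.4) and p. 27] -/
theorem delta_eq_zero_of_good_of_card (p : ℕ) [hp : Fact p.Prime] (v : HeightOneSpectrum (𝓞 ℚ)) (ℓ : ℕ)
    (hvℓ : natGenerator v = ℓ) (hℓp : ℓ ≠ p) (hΔ : ¬ (ℓ : ℤ) ∣ E₀.Δ) {n : ℕ}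
    (hcard : Nat.card ((E₀.map (Int.castRingHom (ZMod ℓ))).toAffine.Point) = n) (hpn : ¬ (p : ℤ) ∣ (n : ℤ)) :
    delta W p v = 0 := by
  subst hvℓ
  haveI := Fact.mk (primesEquiv v).2
  have hgood : W.HasGoodReductionAt v := hasGoodReductionAt_of_not_dvd hI v (by exact_mod_cast hΔ)
  have htr : W.frobeniusTraceAt v = ((natGenerator v : ℕ) : ℤ) + 1 - n := by
    rw [frobeniusTraceAt_eq_frobeniusTrace]
    change W.frobeniusTrace (natGenerator v) = _
    rw [frobeniusTrace_eq hI hcard]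
  have hndvd : ¬ (p : ℤ) ∣ ((natGenerator v : ℕ) + 1 - W.frobeniusTraceAt v : ℤ) := by
    rw [htr]; ring_nf; exact hpn
  rw [delta_eq, (dMultiplicity_eq_zero_iff_of_hasGoodReductionAt hgood hℓp).mpr hndvd, mul_zero]

/-- Sanity at `ℓ = 2`: the curve `y² + y = x³ + x² + x` over `𝔽₂` (the reduction of any integer model with
`(a₁,a₂,a₃,a₄,a₆) ≡ (0,1,1,1,0) (mod 2)`) has `3` points — the way the records supply `hcard`. [folklore] -/
theorem natCard_point_F2_example :
    Nat.card (((⟨2, 1, -1, 3, 4⟩ : WeierstrassCurve ℤ).map (Int.castRingHom (ZMod 2))).toAffine.Point) = 3 := by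
  rw [show ((⟨2, 1, -1, 3, 4⟩ : WeierstrassCurve ℤ).map (Int.castRingHom (ZMod 2))) =
      (⟨0, 1, 1, 1, 0⟩ : WeierstrassCurve (ZMod 2)) from by ext <;> decide,
    natCard_point_eq_one_add_card _ (by decide)]
  decide

end Summit.BirchSwinnertonDyer.BirchSwinnertonDyer.Theorems.CongruenceRoad

end
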